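/-
Copyright (c) 2026 the pub-hodgecm-mathlib formalisation cell (harness21).  Prover seat hodgecm-mathlib-K2E3-p17 (g8), Track B «K2-LIT» ∕ h413
(`stmt-HodgeConjecture-24833`), line `K2_E3_EllipticInputs`, leaf (nsc-S-A′), H-layer glue brick HER for the case bricks C1′∕C1″∕C2 of the architect's
`MEMO-SA-architecture.v2.K2E3-p25-g2.md` §3 («`Wh(D) = 0` ⇒ every subquotient `ω` of `D` is `ψ_nd`-degenerate»).  2026-09-04.
-/
import Summits.HodgeConjecture.HodgeConjecture.Theorems.K2E3GL3DegenerateJacquetVanishing   -- ★ DEG (K2E3-p23 g6): `coinvariantsMk_whittakerTwist_eq_zero_of_not_isGeneric`; brings ★ `WhittakerTwistedJacquet`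
import Literature.NumberTheory.Automorphic.ParabolicInductionQuotientProofs               -- ★ `Subrepresentation.quotientRep`, `Subrepresentation.mkQ`
import Literature.RepresentationTheory.Semisimple.SubrepresentationEquiv                  -- ★ `Subrepresentation.subtypeIntertwiningMap_injective`
import HarnessLib

/-!
# Crux `H413` — leaf (nsc-S-A′), glue brick HER: `(H, θ)`-DEGENERACY AND NON-GENERICITY PASS TO SUBREPRESENTATIONS AND QUOTIENTS

Cell `hodgecm-mathlib`, Track B; THEOREMS ONLY; count-neutral helper (`--supports stmt-HodgeConjecture-24833 --as helper`).

A representation `ρ` of `G` is `(H, θ)`-DEGENERATE when its `θ`-localisation `r_{H,θ}(ρ) = V ⧸ V(H, θ)` (Mathlib coinvariants of ★ `ρ.charTwist H θ`) vanishes: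
`∀ v, Coinvariants.mk (ρ.charTwist H θ) v = 0`.  The inputs `hnd` (`ψ_nd`-degenerate, `θ = ψ_U`) and `hdeg` (`θ′`∕`θ‴`-degenerate) of ★ LEV-3
(`K2E3GL3DegenerateLevelOne{,Mirror}`) are of this form.  This file records that degeneracy is INHERITED:
* §1 (any `G`, `H`, `θ`): by QUOTIENTS — along any surjective intertwining map (`forall_mk_charTwist_eq_zero_of_surjective`, functoriality of coinvariants), and by
  SUBREPRESENTATIONS — along any injective intertwining map into a SMOOTH `ρ₂`, when `H` is a union of compact open subgroups and `θ` has open kernel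
  (`forall_mk_charTwist_eq_zero_of_injective`: ★ left exactness `coinvariantsMap_injective_of_isLimitOfCompactOpen` [BZ77, Prop. 1.9 (a)] for the smooth twist
  ★ `IsSmooth.charTwist`); `Subrepresentation` forms `…_quotientRep`, `…_toRepresentation`.
* §2 (`GL_n`, `θ = ψ_U`): `forall_mk_whittakerTwist_eq_zero_quotientRep` ∕ `_toRepresentation` (★ `twistedJacquetMap_injective`), and the `IsGeneric` forms
  **`not_isGeneric_quotientRep`** (pull-back of a Whittaker functional — no hypotheses) and **`not_isGeneric_toRepresentation`** (`π` smooth, `ψ` continuous), with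
  `isGeneric_of_mk_whittakerTwist_ne_zero` (`J_ψ(π) ≠ 0 ⇒ π` generic, ★ `whittakerFunctionalsEquivDual`).  So every subquotient of a non-generic smooth `D` is non-generic.

HONEST LABEL: HC_CM is proved only modulo the 7 printed citations (2 remaining named inputs: hLiu418 = stmt-HodgeConjecture-24832, h413 =
stmt-HodgeConjecture-24833) until rung 0 closes; count-neutral helper.

## References
* [BernsteinZelevinskyASENS1977] I. N. Bernstein, A. V. Zelevinsky, *Induced representations of reductive p-adic groups I*, Ann. Sci. ÉNS 10 (1977), §1.8 (b), Prop. 1.9 (a).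
* [Bump1997] D. Bump, *Automorphic forms and representations*, CUP 1997, Props. 4.4.2–4.4.4 (PDF p. 462).
-/

set_option autoImplicit false
-- the mandated namespace repeats `HodgeConjecture.HodgeConjecture`, as in every `Theorems/*.lean` of this sub-problem
set_option linter.dupNamespace false

noncomputable section

open Representation Function Literature.NumberTheory.Automorphic Literature.NumberTheory.GaloisRepresentations.IsNonarchimedeanLocalField
open Literature.RepresentationTheory.FiniteGroups Literature.RepresentationTheory.Semisimple
open scoped MatrixGroups
open Summit.HodgeConjecture.HodgeConjecture.Cruxes.H413.K2E3GL3DegenerateJacquetVanishing (coinvariantsMk_whittakerTwist_eq_zero_of_not_isGeneric)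

namespace Summit.HodgeConjecture.HodgeConjecture.Cruxes.H413.K2E3DegenerateSubquotientHeredity

/-! ## §1 `(H, θ)`-degeneracy along surjections, injections, quotients, subrepresentations -/

section General

variable {k G : Type*} [CommRing k] [Group G] {H : Subgroup G} {θ : ↥H →* kˣ}
  {V₁ V₂ : Type*} [AddCommGroup V₁] [Module k V₁] [AddCommGroup V₂] [Module k V₂] {ρ₁ : Representation k G V₁} {ρ₂ : Representation k G V₂}

/-- An intertwining map `f : ρ₁ → ρ₂` intertwines the `θ`-twisted restrictions, hence induces `r_{H,θ}(f) : [v] ↦ [f v]`; recorded as the pointwise identity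
`Coinvariants.mk (ρ₂.charTwist H θ) (f v) = (Coinvariants.map _ _ F) (Coinvariants.mk (ρ₁.charTwist H θ) v)` for the twisted map `F` (same linear map).
[cite: BernsteinZelevinskyASENS1977, §1.8 (b)] -/
theorem exists_coinvariantsMap_charTwist (f : ρ₁.IntertwiningMap ρ₂) :
    ∃ F : (ρ₁.charTwist H θ).IntertwiningMap (ρ₂.charTwist H θ), (∀ v, F v = f v) ∧
      ∀ v, Coinvariants.map _ _ F (Coinvariants.mk (ρ₁.charTwist H θ) v) = Coinvariants.mk (ρ₂.charTwist H θ) (f v) :=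
  ⟨⟨f.toLinearMap, fun h => LinearMap.ext fun v => by
      simp only [LinearMap.comp_apply, Representation.charTwist_apply, Representation.IntertwiningMap.toLinearMap_apply, Units.smul_def, map_smul,
        f.isIntertwining]⟩,
    fun _ => rfl, fun _ => rfl⟩

/-- **DEGENERACY PASSES ALONG SURJECTIONS**: if `r_{H,θ}(ρ₁) = 0` and `f : ρ₁ ↠ ρ₂` is a surjective intertwining map then `r_{H,θ}(ρ₂) = 0` (right exactness is not even
needed: `[f v] = r_{H,θ}(f)[v] = 0`). [cite: BernsteinZelevinskyASENS1977, §1.8 (b)] -/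
theorem forall_mk_charTwist_eq_zero_of_surjective (f : ρ₁.IntertwiningMap ρ₂) (hf : Function.Surjective f)
    (h : ∀ v, Coinvariants.mk (ρ₁.charTwist H θ) v = 0) (w : V₂) : Coinvariants.mk (ρ₂.charTwist H θ) w = 0 := by
  obtain ⟨F, -, hF⟩ := exists_coinvariantsMap_charTwist (H := H) (θ := θ) f
  obtain ⟨v, rfl⟩ := hf w
  rw [← hF v, h v, map_zero]

/-- **DEGENERACY PASSES TO QUOTIENTS**: `r_{H,θ}(ρ) = 0 ⇒ r_{H,θ}(ρ ⁄ N) = 0` for every subrepresentation `N`. [cite: BernsteinZelevinskyASENS1977, §1.8 (b)] -/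
theorem forall_mk_charTwist_eq_zero_quotientRep {V : Type*} [AddCommGroup V] [Module k V] (ρ : Representation k G V)
    (h : ∀ v, Coinvariants.mk (ρ.charTwist H θ) v = 0) (N : Subrepresentation ρ) (x : V ⧸ N.toSubmodule) :
    Coinvariants.mk (N.quotientRep.charTwist H θ) x = 0 :=
  forall_mk_charTwist_eq_zero_of_surjective N.mkQ N.mkQ_surjective h x

end General

section Injective

variable {k G : Type*} [Field k] [CharZero k] [Group G] [TopologicalSpace G] [IsTopologicalGroup G] {H : Subgroup G} {θ : ↥H →* kˣ}
  {V₁ V₂ : Type*} [AddCommGroup V₁] [Module k V₁] [AddCommGroup V₂] [Module k V₂] {ρ₁ : Representation k G V₁} {ρ₂ : Representation k G V₂}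

/-- **DEGENERACY PASSES ALONG INJECTIONS INTO A SMOOTH REPRESENTATION** (`H` a union of compact open subgroups, `θ` with open kernel, `k` a field of characteristic `0`):
if `r_{H,θ}(ρ₂) = 0`, `ρ₂` is smooth and `f : ρ₁ ↪ ρ₂` is injective then `r_{H,θ}(ρ₁) = 0` — ★ left exactness `coinvariantsMap_injective_of_isLimitOfCompactOpen` for the smooth
twist ★ `IsSmooth.charTwist`. [cite: BernsteinZelevinskyASENS1977, Prop. 1.9 (a)] [cite: Bump1997, Prop. 4.4.3 (PDF p. 462)] -/
theorem forall_mk_charTwist_eq_zero_of_injective (hH : IsLimitOfCompactOpen ↥H) (h₂ : ρ₂.IsSmooth) (hθ : IsOpen (θ.ker : Set ↥H))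
    (f : ρ₁.IntertwiningMap ρ₂) (hf : Function.Injective f) (h : ∀ w, Coinvariants.mk (ρ₂.charTwist H θ) w = 0) (v : V₁) :
    Coinvariants.mk (ρ₁.charTwist H θ) v = 0 := by
  obtain ⟨F, hFf, hF⟩ := exists_coinvariantsMap_charTwist (H := H) (θ := θ) f
  have hinj := Representation.coinvariantsMap_injective_of_isLimitOfCompactOpen hH (h₂.charTwist H hθ) F (fun a b hab => hf (by rw [← hFf, ← hFf]; exact hab))
  apply hinj
  rw [hF, h, map_zero]

/-- **DEGENERACY PASSES TO SUBREPRESENTATIONS OF A SMOOTH REPRESENTATION**: `ρ` smooth, `H` a union of compact open subgroups, `θ` with open kernel: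
`r_{H,θ}(ρ) = 0 ⇒ r_{H,θ}(N) = 0`. [cite: BernsteinZelevinskyASENS1977, Prop. 1.9 (a)] -/
theorem forall_mk_charTwist_eq_zero_toRepresentation {V : Type*} [AddCommGroup V] [Module k V] (ρ : Representation k G V) (hρ : ρ.IsSmooth)
    (hH : IsLimitOfCompactOpen ↥H) (hθ : IsOpen (θ.ker : Set ↥H)) (h : ∀ v, Coinvariants.mk (ρ.charTwist H θ) v = 0) (N : Subrepresentation ρ)
    (x : ↥N.toSubmodule) : Coinvariants.mk (N.toRepresentation.charTwist H θ) x = 0 :=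
  forall_mk_charTwist_eq_zero_of_injective hH hρ hθ (Subrepresentation.subtypeIntertwiningMap N) (Subrepresentation.subtypeIntertwiningMap_injective N) h x

/-- **… AND TO SUBQUOTIENTS**: `r_{H,θ}(ρ) = 0 ⇒ r_{H,θ}(N ⁄ N′) = 0` for `N′ ≤ N ≤ ρ` (`N′` a subrepresentation of `N.toRepresentation`). [cite: BernsteinZelevinskyASENS1977, Prop. 1.9 (a)] -/
theorem forall_mk_charTwist_eq_zero_subquotient {V : Type*} [AddCommGroup V] [Module k V] (ρ : Representation k G V) (hρ : ρ.IsSmooth)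
    (hH : IsLimitOfCompactOpen ↥H) (hθ : IsOpen (θ.ker : Set ↥H)) (h : ∀ v, Coinvariants.mk (ρ.charTwist H θ) v = 0) (N : Subrepresentation ρ)
    (N' : Subrepresentation N.toRepresentation) (x : ↥N.toSubmodule ⧸ N'.toSubmodule) : Coinvariants.mk (N'.quotientRep.charTwist H θ) x = 0 :=
  forall_mk_charTwist_eq_zero_quotientRep _ (forall_mk_charTwist_eq_zero_toRepresentation ρ hρ hH hθ h N) N' x

end Injective

/-! ## §2 `GL_n`: the Whittaker case (`θ = ψ_U`) and `IsGeneric` -/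

section Whittaker

variable {R : Type*} [CommRing R] {n : ℕ} {V : Type*} [AddCommGroup V] [Module ℂ V] (π : Representation ℂ (GL (Fin n) R) V) (ψ : AddChar R Circle)

/-- **`ψ_nd`-degeneracy passes to quotients**: `J_ψ(π) = 0 ⇒ J_ψ(π ⁄ N) = 0`. [cite: Bump1997, Prop. 4.4.4 (PDF p. 462)] -/
theorem forall_mk_whittakerTwist_eq_zero_quotientRep (h : ∀ v, Coinvariants.mk (whittakerTwist π ψ) v = 0) (N : Subrepresentation π)
    (x : V ⧸ N.toSubmodule) : Coinvariants.mk (whittakerTwist N.quotientRep ψ) x = 0 :=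
  forall_mk_charTwist_eq_zero_quotientRep π h N x

/-- **`J_ψ(π) ≠ 0 ⇒ π` is `ψ`-generic** (`Hom_U(π, ψ) ≅ J_ψ(π)^*` ★ `whittakerFunctionalsEquivDual`; converse of ★ DEG `coinvariantsMk_whittakerTwist_eq_zero_of_not_isGeneric`).
[cite: Bump1997, Prop. 4.4.4 (PDF p. 462)] -/
theorem isGeneric_of_mk_whittakerTwist_ne_zero {v : V} (hv : Coinvariants.mk (whittakerTwist π ψ) v ≠ 0) : IsGeneric π ψ :=
  fun hbot => hv (coinvariantsMk_whittakerTwist_eq_zero_of_not_isGeneric π ψ (fun hg => hg hbot) v)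

/-- **NON-GENERICITY PASSES TO QUOTIENTS** (no hypotheses): a non-zero Whittaker functional of `π ⁄ N` pulls back to one of `π`. [cite: Bump1997, §4.4] -/
theorem not_isGeneric_quotientRep (h : ¬ IsGeneric π ψ) (N : Subrepresentation π) : ¬ IsGeneric N.quotientRep ψ := by
  intro hN
  obtain ⟨Λ, hΛ, hΛ0⟩ := (isGeneric_iff _ _).1 hN
  refine h ((isGeneric_iff _ _).2 ⟨Λ ∘ₗ N.mkQ.toLinearMap, (mem_whittakerFunctionals_iff _).2 fun u v => ?_, fun h0 => hΛ0 ?_⟩)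
  · rw [LinearMap.comp_apply, LinearMap.comp_apply, Representation.IntertwiningMap.toLinearMap_apply, Representation.IntertwiningMap.toLinearMap_apply,
      N.mkQ.isIntertwining, (mem_whittakerFunctionals_iff _).1 hΛ u]
  · refine LinearMap.ext fun x => ?_
    obtain ⟨v, rfl⟩ := N.mkQ_surjective x
    have h1 := LinearMap.congr_fun h0 v
    rw [LinearMap.comp_apply, Representation.IntertwiningMap.toLinearMap_apply, LinearMap.zero_apply] at h1
    rw [h1, LinearMap.zero_apply]

end Whittaker

section WhittakerLocal

variable {F : Type*} [Field F] [ValuativeRel F] [TopologicalSpace F] [IsNonarchimedeanLocalField F] {n : ℕ}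
  {V : Type*} [AddCommGroup V] [Module ℂ V] (π : Representation ℂ (GL (Fin n) F) V) {ψ : AddChar F Circle}

/-- **`ψ_nd`-degeneracy passes to subrepresentations of a smooth `π`** (`ψ` continuous): `J_ψ(π) = 0 ⇒ J_ψ(N) = 0` (★ `twistedJacquetMap_injective`).
[cite: BernsteinZelevinskyASENS1977, Prop. 1.9 (a)] [cite: Bump1997, Prop. 4.4.3 (PDF p. 462)] -/
theorem forall_mk_whittakerTwist_eq_zero_toRepresentation (hπ : π.IsSmooth) (hψ : Continuous ψ) (h : ∀ v, Coinvariants.mk (whittakerTwist π ψ) v = 0)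
    (N : Subrepresentation π) (x : ↥N.toSubmodule) : Coinvariants.mk (whittakerTwist N.toRepresentation ψ) x = 0 := by
  have hinj := twistedJacquetMap_injective (ψ := ψ) hπ hψ (Subrepresentation.subtypeIntertwiningMap N) (Subrepresentation.subtypeIntertwiningMap_injective N)
  apply hinj
  rw [twistedJacquetMap_mk, h, map_zero]

/-- `ψ_nd`-degeneracy passes to subquotients `N ⁄ N′` of a smooth `π`. [cite: BernsteinZelevinskyASENS1977, Prop. 1.9 (a)] -/
theorem forall_mk_whittakerTwist_eq_zero_subquotient (hπ : π.IsSmooth) (hψ : Continuous ψ) (h : ∀ v, Coinvariants.mk (whittakerTwist π ψ) v = 0)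
    (N : Subrepresentation π) (N' : Subrepresentation N.toRepresentation) (x : ↥N.toSubmodule ⧸ N'.toSubmodule) :
    Coinvariants.mk (whittakerTwist N'.quotientRep ψ) x = 0 :=
  forall_mk_whittakerTwist_eq_zero_quotientRep _ ψ (forall_mk_whittakerTwist_eq_zero_toRepresentation π hπ hψ h N) N' x

/-- **NON-GENERICITY PASSES TO SUBREPRESENTATIONS OF A SMOOTH `π`** (`ψ` continuous). [cite: BernsteinZelevinskyASENS1977, Prop. 1.9 (a)] [cite: Bump1997, Prop. 4.4.3–4.4.4] -/
theorem not_isGeneric_toRepresentation (hπ : π.IsSmooth) (hψ : Continuous ψ) (h : ¬ IsGeneric π ψ) (N : Subrepresentation π) :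
    ¬ IsGeneric N.toRepresentation ψ := by
  intro hN
  obtain ⟨Λ, hΛ, hΛ0⟩ := (isGeneric_iff _ _).1 hN
  have hzero := forall_mk_whittakerTwist_eq_zero_toRepresentation π hπ hψ (coinvariantsMk_whittakerTwist_eq_zero_of_not_isGeneric π ψ h) N
  apply hΛ0
  ext x
  rw [LinearMap.zero_apply, ← whittakerFunctionalsEquivDual_apply_mk N.toRepresentation ψ ⟨Λ, hΛ⟩ x, hzero x, map_zero]

/-- **NON-GENERICITY PASSES TO SUBQUOTIENTS OF A SMOOTH `π`**: every subquotient `N ⁄ N′` of a non-generic smooth `π` is non-generic (`ψ` continuous) — the form used by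
the case bricks («`Wh(D) = 0` ⇒ every subquotient of `D` is `ψ_nd`-degenerate»). [cite: BernsteinZelevinskyASENS1977, Prop. 1.9 (a)] [cite: Bump1997, §4.4] -/
theorem not_isGeneric_subquotient (hπ : π.IsSmooth) (hψ : Continuous ψ) (h : ¬ IsGeneric π ψ) (N : Subrepresentation π)
    (N' : Subrepresentation N.toRepresentation) : ¬ IsGeneric N'.quotientRep ψ :=
  not_isGeneric_quotientRep _ ψ (not_isGeneric_toRepresentation π hπ hψ h N) N'

omit [ValuativeRel F] [TopologicalSpace F] [IsNonarchimedeanLocalField F] in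
/-- Transport of non-genericity along a surjective intertwining map (in particular along an isomorphism). [folklore] -/
theorem not_isGeneric_of_surjective {W : Type*} [AddCommGroup W] [Module ℂ W] {σ : Representation ℂ (GL (Fin n) F) W} (f : π.IntertwiningMap σ)
    (hf : Function.Surjective f) (h : ¬ IsGeneric π ψ) : ¬ IsGeneric σ ψ := by
  intro hσ
  obtain ⟨Λ, hΛ, hΛ0⟩ := (isGeneric_iff _ _).1 hσ
  refine h ((isGeneric_iff _ _).2 ⟨Λ ∘ₗ f.toLinearMap, (mem_whittakerFunctionals_iff _).2 fun u v => ?_, fun h0 => hΛ0 ?_⟩)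
  · rw [LinearMap.comp_apply, LinearMap.comp_apply, Representation.IntertwiningMap.toLinearMap_apply, Representation.IntertwiningMap.toLinearMap_apply,
      f.isIntertwining, (mem_whittakerFunctionals_iff _).1 hΛ u]
  · refine LinearMap.ext fun x => ?_
    obtain ⟨v, rfl⟩ := hf x
    have h1 := LinearMap.congr_fun h0 v
    rw [LinearMap.comp_apply, Representation.IntertwiningMap.toLinearMap_apply, LinearMap.zero_apply] at h1
    rw [h1, LinearMap.zero_apply]

end WhittakerLocal

end Summit.HodgeConjecture.HodgeConjecture.Cruxes.H413.K2E3DegenerateSubquotientHeredity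

end
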